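import Summits.KontsevichZagierPeriods.KontsevichZagierPeriods.Theses.FurushoPentagon
import Summits.KontsevichZagierPeriods.KontsevichZagierPeriods.Theorems.FurushoPentagonReducedPeriodRingDefs
import Literature.NumberTheory.Transcendental.KZCubicalCalculus
import Literature.NumberTheory.Transcendental.KZLogCalculusProofs
import Literature.NumberTheory.Transcendental.KZSemiCanonicalReductionDimOne
import Literature.NumberTheory.Transcendental.SemialgebraicAlgebraicPoints
import Literature.NumberTheory.Transcendental.EllIterRep
import Literature.NumberTheory.Transcendental.SemialgebraicMapsProofs
import Summits.KontsevichZagierPeriods.KontsevichZagierPeriods.Theorems.SymplecticScissorsCurvePeriodsTransferStubSaPieceFacts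

/-!
# `SectorToKernel`, line `effective-cube-surjection`, dimension-one rung: analytic pieces

Stub R7 `stub_decomposeDimOne` of the dimension-one rung of the resolution stub S1 of the crux
`FurushoPentagon.SectorToKernel` (stmt-KontsevichZagierPeriods-10813): every one-dimensional
Kontsevich–Zagier representation `[σ, f]` is, modulo the KZ relations, a finite sum of
representations on `(0, 1) ⊆ ℝ¹` with integrands real-analytic on `(0, 1)`. Inside the calculus:
compactification by Viu-Sos' inversion charts (`decomp_compactify`, rules (1), (2); afterwards all
domains lie in `[-1, 1]`); cutting at finitely many ALGEBRAIC points — boundary points of `σ` and the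
points where `f` fails to be analytic, both from the tree theorem `stub_saPieceFacts` of
`SymplecticScissors.CurvePeriodsTransfer` — which is rule (1), points being null (`decomp_bounded`);
the affine rule-(2) move of each cell onto `(0, 1)`, `ℚ`-definable as its end points are algebraic
(`decomp_affine`). The granted hypothesis (analyticity off a finite set, stub R2) is subsumed by
`stub_saPieceFacts` and not used. References: M. Kontsevich, D. Zagier, *Periods* (2001), §1.2;
L. van den Dries, *Tame Topology and O-minimal Structures* (1998), Ch. 3 (1.2); J. Viu-Sos,
*A semi-canonical reduction for periods of Kontsevich–Zagier* (2021), Thm. 2.1.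
-/

noncomputable section

namespace Summit.KontsevichZagierPeriods.FurushoPentagon.SectorToKernel

open Set MeasureTheory
open Literature.NumberTheory.Transcendental
open Literature.NumberTheory.Transcendental.KZ hiding cubicalSpan
open Summit.KontsevichZagierPeriods.KontsevichZagierPeriods.Theses.FurushoPentagon
open Summit.KontsevichZagierPeriods.FurushoPentagon.ReducedPeriodRing (unitCube cubicalGens cubicalSpan)
open Literature.ModelTheory.ExponentialFields (IsSemialgebraic)
open Summit.KontsevichZagierPeriods.SymplecticScissors (CurvePeriodsTransfer.stub_saPieceFacts
  CurvePeriodsTransfer.exists_finset_mem_iff_mem CurvePeriodsTransfer.mem_of_mem_of_cell)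

/-! ### Bookkeeping -/

/-- Concatenation of finite decompositions modulo relations: if every `[R i]`, `i ∈ s`, is a finite
sum of classes of representations with property `P` modulo relations, so is `∑ i ∈ s, [R i]`. [folklore] -/
theorem decomp_concat {ι : Type*} (P : IntegralRep 1 → Prop) (s : Finset ι)
    (R : ι → IntegralRep 1) (h : ∀ i ∈ s, ∃ (k : ℕ) (v : Fin k → IntegralRep 1),
      (∀ j, P (v j)) ∧ of (R i) - ∑ j, of (v j) ∈ relations) :
    ∃ (k : ℕ) (v : Fin k → IntegralRep 1),
      (∀ j, P (v j)) ∧ ∑ i ∈ s, of (R i) - ∑ j, of (v j) ∈ relations := by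
  classical
  induction s using Finset.induction_on with
  | empty => exact ⟨0, Fin.elim0, fun j => j.elim0, by simp [relations.zero_mem]⟩
  | insert a s ha ih =>
    obtain ⟨k₁, v₁, hv₁, h₁⟩ := h a (Finset.mem_insert_self a s)
    obtain ⟨k₂, v₂, hv₂, h₂⟩ := ih fun i hi => h i (Finset.mem_insert_of_mem hi)
    refine ⟨k₁ + k₂, Fin.append v₁ v₂, fun j => ?_, ?_⟩
    · refine Fin.addCases (motive := fun j => P (Fin.append v₁ v₂ j)) (fun j => ?_) (fun j => ?_) j
      · simpa only [Fin.append_left] using hv₁ j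
      · simpa only [Fin.append_right] using hv₂ j
    · rw [Finset.sum_insert ha, Fin.sum_univ_add]
      simp only [Fin.append_left, Fin.append_right]
      rw [add_sub_add_comm]
      exact relations.add_mem h₁ h₂

/-- The cell of a finite set of cut points `C` around a point `x ∉ C` lying between two cut points:
the largest cut point below `x` and the smallest one above. [folklore] -/
theorem decomp_exists_cell (C : Finset ℝ) {a b x : ℝ} (ha : a ∈ C) (hb : b ∈ C) (hax : a < x)
    (hxb : x < b) (hx : x ∉ C) : ∃ u ∈ C, ∃ v ∈ C, x ∈ Ioo u v ∧ ∀ y ∈ C, y ∉ Ioo u v := by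
  classical
  have hLn : (C.filter (· < x)).Nonempty := ⟨a, Finset.mem_filter.2 ⟨ha, hax⟩⟩
  have hUn : (C.filter (x < ·)).Nonempty := ⟨b, Finset.mem_filter.2 ⟨hb, hxb⟩⟩
  refine ⟨_, (Finset.mem_filter.1 (Finset.max'_mem _ hLn)).1, _,
    (Finset.mem_filter.1 (Finset.min'_mem _ hUn)).1, ⟨(Finset.mem_filter.1
      (Finset.max'_mem _ hLn)).2, (Finset.mem_filter.1 (Finset.min'_mem _ hUn)).2⟩,
    fun y hy hyI => ?_⟩
  rcases lt_trichotomy y x with h | rfl | h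
  · exact not_lt_of_ge (Finset.le_max' _ y (Finset.mem_filter.2 ⟨hy, h⟩)) hyI.1
  · exact hx hy
  · exact not_lt_of_ge (Finset.min'_le _ y (Finset.mem_filter.2 ⟨hy, h⟩)) hyI.2

/-! ### Rule (2): the affine move of a cell onto the unit interval -/

/-- **The affine move.** A representation `W` on the cell `{x | p < x₀ < q}` (`p < q` real
algebraic) whose integrand is analytic on `(p, q)` differs by a relation from the representation
`[(0,1), x ↦ f(p + (q − p) x₀) (q − p)]`, an instance of Kontsevich–Zagier's rule (2) along the
`ℚ`-semialgebraic affine bijection `x ↦ p + (q − p) x` (Jacobian `q − p`); the new integrand is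
analytic on `(0, 1)`. [Kontsevich–Zagier 2001, §1.2, rule (2)] [folklore] -/
theorem decomp_affine (W : IntegralRep 1) {p q : ℝ} (hpq : p < q) (hp : IsAlgebraic ℚ p)
    (hq : IsAlgebraic ℚ q) (hW : W.domain = {x : Fin 1 → ℝ | x 0 ∈ Ioo p q})
    (han : ∀ s ∈ Ioo p q, AnalyticAt ℝ (fun s : ℝ => W.integrand (fun _ => s)) s) :
    ∃ v : IntegralRep 1, (v.domain = {x : Fin 1 → ℝ | x 0 ∈ Set.Ioo (0:ℝ) 1} ∧
      ∀ s ∈ Set.Ioo (0:ℝ) 1, AnalyticAt ℝ (fun s : ℝ => v.integrand (fun _ => s)) s) ∧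
      of W - of v ∈ relations := by
  have hc : 0 < q - p := sub_pos.2 hpq
  have hD : IsSemialgebraic ℚ {x : Fin 1 → ℝ | x 0 ∈ Ioo (0:ℝ) 1} :=
    (isSemialgebraic_setOf_const_lt_apply isAlgebraic_zero 0).inter
      (isSemialgebraic_setOf_apply_lt_const isAlgebraic_one 0)
  have hDm := Literature.ModelTheory.ExponentialFields.IsSemialgebraic.measurableSet_holds hD
  -- the substitution, its derivative, Jacobian, injectivity, image and semialgebraicity
  set Φ : (Fin 1 → ℝ) → (Fin 1 → ℝ) := fun x => (fun _ => p) + (q - p) • x with hΦ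
  set Φ' : (Fin 1 → ℝ) →L[ℝ] (Fin 1 → ℝ) := (q - p) • ContinuousLinearMap.id ℝ (Fin 1 → ℝ)
    with hΦ'
  have hder : ∀ x, HasFDerivAt Φ Φ' x := fun x =>
    ((hasFDerivAt_id x).const_smul (q - p)).const_add (fun _ => p)
  have hdet : |Φ'.det| = q - p := by
    rw [show Φ'.det = q - p by simp [hΦ', ContinuousLinearMap.det, LinearMap.det_smul],
      abs_of_pos hc]
  have hinj : InjOn Φ {x : Fin 1 → ℝ | x 0 ∈ Ioo (0:ℝ) 1} := fun x _ y _ hxy => by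
    simp only [hΦ] at hxy
    exact smul_right_injective (Fin 1 → ℝ) hc.ne' (add_left_cancel hxy)
  have himage : Φ '' {x : Fin 1 → ℝ | x 0 ∈ Ioo (0:ℝ) 1} = W.domain := by
    rw [hW]
    ext y
    simp only [mem_image, mem_setOf_eq, hΦ, mem_Ioo]
    constructor
    · rintro ⟨x, hx, rfl⟩
      simp only [Pi.add_apply, Pi.smul_apply, smul_eq_mul]
      constructor <;> nlinarith [hx.1, hx.2]
    · intro hy
      refine ⟨fun _ => (y 0 - p) / (q - p),
        ⟨div_pos (sub_pos.2 hy.1) hc, (div_lt_one hc).2 (by linarith [hy.2])⟩, ?_⟩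
      funext i
      rw [Subsingleton.elim i 0]
      simp only [Pi.add_apply, Pi.smul_apply, smul_eq_mul]
      field_simp
      ring
  have hΦsa : IsSemialgebraicMapOn ℚ {x : Fin 1 → ℝ | x 0 ∈ Ioo (0:ℝ) 1} Φ :=
    IsSemialgebraicMapOn.of_forall hD fun j =>
      (IsSemialgebraicFunOn.add_holds (isSemialgebraicFunOn_const_of_isAlgebraic hD hp)
        (IsSemialgebraicFunOn.mul_holds (isSemialgebraicFunOn_const_of_isAlgebraic hD (hq.sub hp))
          (isSemialgebraicFunOn_apply hD j))).congr fun x _ => by simp [hΦ]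
  -- the rescaled representation on the unit interval
  have hsa : IsSemialgebraicFunOn ℚ {x : Fin 1 → ℝ | x 0 ∈ Ioo (0:ℝ) 1}
      (fun x => W.integrand (Φ x) * (q - p)) :=
    (IsSemialgebraicFunOn.mul_holds
      (IsSemialgebraicFunOn.comp_isSemialgebraicMapOn_holds W.isSemialgebraicFunOn_integrand hΦsa
        fun x hx => himage ▸ mem_image_of_mem Φ hx)
      (isSemialgebraicFunOn_const_of_isAlgebraic hD (hq.sub hp))).congr fun x _ => rfl
  have hint : IntegrableOn (fun x => W.integrand (Φ x) * (q - p))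
      {x : Fin 1 → ℝ | x 0 ∈ Ioo (0:ℝ) 1} := by
    refine ((integrableOn_image_iff_integrableOn_abs_det_fderiv_smul volume hDm
      (fun x _ => (hder x).hasFDerivWithinAt) hinj W.integrand).1
      (by rw [himage]; exact W.integrableOn)).congr_fun (fun x _ => ?_) hDm
    show |Φ'.det| • W.integrand (Φ x) = W.integrand (Φ x) * (q - p)
    rw [hdet, smul_eq_mul, mul_comm]
  refine ⟨⟨{x : Fin 1 → ℝ | x 0 ∈ Ioo (0:ℝ) 1}, fun x => W.integrand (Φ x) * (q - p), hD, hsa,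
    hint⟩, ⟨rfl, fun s hs => ?_⟩, ?_⟩
  · show AnalyticAt ℝ (fun s : ℝ => W.integrand (Φ (fun _ => s)) * (q - p)) s
    have hΦs : ∀ t : ℝ, Φ (fun _ => t) = fun _ => p + (q - p) * t := fun t =>
      funext fun i => by simp [hΦ]
    simp_rw [hΦs]
    have h1 : AnalyticAt ℝ (fun t : ℝ => W.integrand (fun _ => t)) (p + (q - p) * s) :=
      han _ ⟨by nlinarith [hs.1, hs.2], by nlinarith [hs.1, hs.2]⟩
    have h2 : AnalyticAt ℝ (fun t : ℝ => p + (q - p) * t) s :=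
      analyticAt_const.add (analyticAt_const.mul analyticAt_id)
    exact (h1.comp_of_eq h2 rfl).mul analyticAt_const
  · have hcov : of ⟨{x : Fin 1 → ℝ | x 0 ∈ Ioo (0:ℝ) 1}, fun x => W.integrand (Φ x) * (q - p),
        hD, hsa, hint⟩ - of W ∈ changeOfVariablesRel :=
      ⟨1, _, W, Φ, fun _ => Φ', hΦsa, fun x _ => (hder x).hasFDerivWithinAt, hinj, himage.symm,
        fun x _ => by
          show W.integrand (Φ x) * (q - p) = W.integrand (Φ x) * |Φ'.det|
          rw [hdet], rfl⟩
    rw [← neg_sub]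
    exact relations.neg_mem (changeOfVariablesRel_subset_relations hcov)

/-! ### Rules (1) and (2): compactification of the domain -/

open Literature.NumberTheory.Transcendental.PeriodCompactify in
/-- **Compactification at the level of moves** (any dimension): `[σ, f]` differs by relations from
the sum of the `2ⁿ` representations `[pieceDom T σ, v ↦ f(inv T v) · |det D(inv T)(v)|]`, whose
domains lie in `[-1, 1]ⁿ`: split `σ` along the outer regions (rule (1); the complement of their union
is null) and change variables by the involutive chart `inv T` on each piece (rule (2)); the new
integrand is `ℚ`-semialgebraic (composition, times `∏_{i ∈ T} vᵢ⁻²`) and integrable (Jacobian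
formula). [Viu-Sos 2021, Thm. 2.1; Kontsevich–Zagier 2001, §1.2, rules (1), (2)] [folklore] -/
theorem decomp_compactify {n : ℕ} (r : IntegralRep n) :
    ∃ R : Finset (Fin n) → IntegralRep n,
      (∀ T, (R T).domain ⊆ Icc (-1) 1) ∧ of r - ∑ T, of (R T) ∈ relations := by
  have hσ := r.isSemialgebraic_domain
  have hsa : ∀ T : Finset (Fin n), IsSemialgebraicFunOn ℚ (pieceDom T r.domain)
      (fun v => r.integrand (inv T v) * |(invDeriv T v).det|) := fun T => by
    refine IsSemialgebraicFunOn.mul_holds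
      (IsSemialgebraicFunOn.comp_isSemialgebraicMapOn_holds r.isSemialgebraicFunOn_integrand
        (isSemialgebraicMapOn_inv_pieceDom T hσ) fun v hv => hv.2) ?_
    refine (isSemialgebraicFunOn_aeval_div_aeval (isSemialgebraic_pieceDom T hσ)
      (1 : MvPolynomial (Fin n) ℚ) (∏ i ∈ T, MvPolynomial.X i ^ 2) fun v hv => ?_).congr
      fun v _ => ?_
    · rw [aeval_prod_X_sq]
      exact Finset.prod_ne_zero_iff.2 fun i hi => pow_ne_zero _ (ne_zero_of_mem_inner T hv.1 hi)
    · show MvPolynomial.aeval v 1 / MvPolynomial.aeval v (∏ i ∈ T, MvPolynomial.X i ^ 2) =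
        |(invDeriv T v).det|
      rw [abs_det_invDeriv, map_one, aeval_prod_X_sq, one_div, ← Finset.prod_inv_distrib]
  have hint : ∀ T : Finset (Fin n), IntegrableOn
      (fun v => r.integrand (inv T v) * |(invDeriv T v).det|) (pieceDom T r.domain) := fun T => by
    have h0 : IntegrableOn r.integrand (inv T '' pieceDom T r.domain) :=
      image_inv_pieceDom T (σ := r.domain) ▸ r.integrableOn.mono_set inter_subset_left
    refine ((integrableOn_image_iff_integrableOn_abs_det_fderiv_smul volume
      (measurableSet_pieceDom T hσ) (hasFDerivWithinAt_inv_pieceDom T) (injOn_inv_pieceDom T)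
      r.integrand).1 h0).congr_fun (fun v _ => ?_) (measurableSet_pieceDom T hσ)
    show |(invDeriv T v).det| • r.integrand (inv T v) = r.integrand (inv T v) * |(invDeriv T v).det|
    rw [smul_eq_mul, mul_comm]
  set R : Finset (Fin n) → IntegralRep n := fun T => ⟨pieceDom T r.domain,
    fun v => r.integrand (inv T v) * |(invDeriv T v).det|, isSemialgebraic_pieceDom T hσ, hsa T,
    hint T⟩ with hR
  refine ⟨R, fun T => pieceDom_subset_Icc T, ?_⟩
  -- the traces of `r` on the outer regions (rule (1)), each the image of a chart (rule (2))
  have hS : ∀ T, IsSemialgebraic ℚ (r.domain ∩ outer T) := fun T =>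
    hσ.inter (isSemialgebraic_outer T)
  set S : Finset (Fin n) → IntegralRep n := fun T => r.restrict _ (hS T) inter_subset_left with hS'
  have e1 : of r - ∑ T, of (S T) ∈ relations := by
    refine of_sub_sum_of_mem_relations Finset.univ r S (fun T _ => ?_) (fun T _ _ _ => rfl) ?_ ?_
    · rw [show (S T).domain \ r.domain = ∅ from sdiff_eq_empty.mpr inter_subset_left, measure_empty]
    · refine measure_mono_null (fun x hx => ?_) volume_compl_iUnion_outer
      intro hx'
      obtain ⟨T, hT⟩ := mem_iUnion.1 hx'
      exact hx.2 (mem_biUnion (Finset.mem_univ T) ⟨hx.1, hT⟩)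
    · intro T hT T' hT' hne
      rw [show (S T).domain ∩ (S T').domain = ∅ from
        Set.disjoint_iff_inter_eq_empty.mp (pairwiseDisjoint_outer r.domain hT hT' hne),
        measure_empty]
  have e2 : ∀ T, of (R T) - of (S T) ∈ changeOfVariablesRel := fun T =>
    ⟨n, R T, S T, inv T, invDeriv T, isSemialgebraicMapOn_inv_pieceDom T hσ,
      hasFDerivWithinAt_inv_pieceDom T, injOn_inv_pieceDom T, (image_inv_pieceDom T).symm,
      fun v _ => rfl, rfl⟩
  simpa only [sub_sub_sub_cancel_right] using relations.sub_mem e1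
    (sum_sub_sum_mem_relations Finset.univ _ _ fun T _ =>
      changeOfVariablesRel_subset_relations (e2 T))

/-! ### Rule (1): cutting a bounded representation into analytic cells -/

/-- **Cutting a bounded one-dimensional representation into analytic cells.** For `w = [σ, f]` with
`σ ⊆ [-1, 1] ⊆ ℝ¹`: the boundary points of `σ` are finitely many algebraic numbers, and the extension
by zero of `f` to `(-2, 2)` (a `ℚ`-semialgebraic function of one variable) is real-analytic off finitely
many algebraic points (`stub_saPieceFacts`); the complementary open cells of these cut points inside
`σ` carry `f` analytic, cover `σ` up to finitely many points (rule (1), `KZ.of_sub_sum_of_mem_relations`)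
and are moved onto `(0, 1)` by `decomp_affine`. [Kontsevich–Zagier 2001, §1.2; van den Dries 1998,
Ch. 3 (1.2)] [folklore] -/
theorem decomp_bounded (w : IntegralRep 1) (hw : w.domain ⊆ Icc (-1) 1) :
    ∃ (k : ℕ) (v : Fin k → IntegralRep 1), (∀ i, (v i).domain = {x : Fin 1 → ℝ | x 0 ∈ Set.Ioo (0:ℝ) 1}
      ∧ ∀ s ∈ Set.Ioo (0:ℝ) 1, AnalyticAt ℝ (fun s : ℝ => (v i).integrand (fun _ => s)) s) ∧
      of w - ∑ i, of (v i) ∈ relations := by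
  classical
  -- the domain as a subset `A ⊆ (-2, 2)` of the line
  set A : Set ℝ := {s | (fun _ : Fin 1 => s) ∈ w.domain} with hA
  have hdomA : ∀ x : Fin 1 → ℝ, x ∈ w.domain ↔ x 0 ∈ A := fun x => by
    show x ∈ w.domain ↔ (fun _ => x 0) ∈ w.domain
    rw [← eq_const_apply_zero x]
  have hAI : ∀ s ∈ A, s ∈ Ioo (-2:ℝ) 2 := fun s hs => by
    have h := hw hs
    simp only [mem_Icc, Pi.le_def, Pi.neg_apply, Pi.one_apply] at h
    exact ⟨by linarith [h.1 0], by linarith [h.2 0]⟩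
  have h2a : IsAlgebraic ℚ (2:ℝ) := by simpa using isAlgebraic_nat (R := ℚ) (A := ℝ) 2
  have hS : IsSemialgebraic ℚ {z : Fin 1 → ℝ | z 0 ∈ Ioo (-2:ℝ) 2} :=
    (isSemialgebraic_setOf_const_lt_apply h2a.neg 0).inter (isSemialgebraic_setOf_apply_lt_const h2a 0)
  have hdomS : w.domain ⊆ {z : Fin 1 → ℝ | z 0 ∈ Ioo (-2:ℝ) 2} := fun x hx =>
    hAI _ ((hdomA x).1 hx)
  -- the extension by zero `g` of the integrand is `ℚ`-semialgebraic on `(-2, 2)`, hence analytic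
  -- off a finite set `B` of algebraic points
  set g : ℝ → ℝ := fun s => w.domain.indicator w.integrand (fun _ => s) with hg
  have hgsa : IsSemialgebraicFunOn ℚ {z : Fin 1 → ℝ | z 0 ∈ Ioo (-2:ℝ) 2} (fun z => g (z 0)) := by
    have h0 : IsSemialgebraicFunOn ℚ ({z : Fin 1 → ℝ | z 0 ∈ Ioo (-2:ℝ) 2} \ w.domain)
        (fun _ => (0:ℝ)) := by
      simpa using isSemialgebraicFunOn_ratCast (hS.diff w.isSemialgebraic_domain) 0
    have h1 := w.isSemialgebraicFunOn_integrand.union h0 (F := w.domain.indicator w.integrand)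
      (fun x hx => indicator_of_mem hx _) (fun x hx => indicator_of_notMem hx.2 _)
    rw [union_sdiff_cancel hdomS] at h1
    refine h1.congr fun z _ => ?_
    show w.domain.indicator w.integrand z = w.domain.indicator w.integrand (fun _ => z 0)
    rw [← eq_const_apply_zero z]
  obtain ⟨B, hBsub, hBalg, hcell⟩ := (CurvePeriodsTransfer.stub_saPieceFacts).2 g (-2) 2
    (by norm_num) hgsa
  have hanal : ∀ x ∈ Ioo (-2:ℝ) 2, x ∉ B → AnalyticAt ℝ g x := by
    intro x hx hxB
    obtain ⟨u, hu, v, hv, hxuv, havoid⟩ := decomp_exists_cell (insert (-2:ℝ) (insert 2 B))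
      (Finset.mem_insert_self _ _) (Finset.mem_insert_of_mem (Finset.mem_insert_self _ _)) hx.1
      hx.2 (by simp only [Finset.mem_insert, not_or]; exact ⟨hx.1.ne', hx.2.ne, hxB⟩)
    simp only [Finset.mem_insert] at hu hv
    obtain ⟨P, -, hP⟩ := hcell u v (hxuv.1.trans hxuv.2)
      (by rcases hu with h | h | h; exacts [Or.inl h, absurd h (hxuv.1.trans hx.2).ne, Or.inr h])
      (by rcases hv with h | h | h; exacts [absurd h (hx.1.trans hxuv.2).ne', Or.inl h, Or.inr h])
      (fun y hy => havoid y (by simp [hy]))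
    exact (hP x hxuv).1
  -- the cut points: `±2`, `B`, and the boundary points of the domain inside `(-2, 2)`
  obtain ⟨E, hEalg, hE⟩ := CurvePeriodsTransfer.exists_finset_mem_iff_mem w.domain
    w.isSemialgebraic_domain
  set C : Finset ℝ := insert (-2:ℝ) (insert 2 (B ∪ E.filter (fun e => e ∈ Ioo (-2:ℝ) 2))) with hC
  have h2C : (-2:ℝ) ∈ C := Finset.mem_insert_self _ _
  have h2C' : (2:ℝ) ∈ C := Finset.mem_insert_of_mem (Finset.mem_insert_self _ _)
  have hBC : ∀ y ∈ B, y ∈ C := fun y hy =>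
    Finset.mem_insert_of_mem (Finset.mem_insert_of_mem (Finset.mem_union_left _ hy))
  have hEC : ∀ e ∈ E, e ∈ Ioo (-2:ℝ) 2 → e ∈ C := fun e he heI => Finset.mem_insert_of_mem
    (Finset.mem_insert_of_mem (Finset.mem_union_right _ (Finset.mem_filter.2 ⟨he, heI⟩)))
  have hC' : ∀ c ∈ C, IsAlgebraic ℚ c ∧ c ∈ Icc (-2:ℝ) 2 := by
    intro c hc
    simp only [hC, Finset.mem_insert, Finset.mem_union, Finset.mem_filter] at hc
    rcases hc with rfl | rfl | hc | ⟨hc, hc'⟩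
    exacts [⟨h2a.neg, le_rfl, by norm_num⟩, ⟨h2a, by norm_num, le_rfl⟩,
      ⟨hBalg c hc, Ioo_subset_Icc_self (hBsub hc)⟩, ⟨hEalg c hc, Ioo_subset_Icc_self hc'⟩]
  -- the cells of `C` inside `A`, and the restrictions of `w` to them
  set J : Finset (ℝ × ℝ) := (C ×ˢ C).filter
    (fun pq => pq.1 < pq.2 ∧ (∀ y ∈ C, y ∉ Ioo pq.1 pq.2) ∧ Ioo pq.1 pq.2 ⊆ A) with hJ
  have hJC : ∀ i : J, (i.1.1 ∈ C ∧ i.1.2 ∈ C) ∧ i.1.1 < i.1.2 ∧ (∀ y ∈ C, y ∉ Ioo i.1.1 i.1.2) ∧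
      Ioo i.1.1 i.1.2 ⊆ A := fun i => by
    simpa only [hJ, Finset.mem_filter, Finset.mem_product] using i.2
  have hJsa : ∀ i : J, IsSemialgebraic ℚ {x : Fin 1 → ℝ | x 0 ∈ Ioo i.1.1 i.1.2} := fun i =>
    (isSemialgebraic_setOf_const_lt_apply (hC' _ (hJC i).1.1).1 0).inter
      (isSemialgebraic_setOf_apply_lt_const (hC' _ (hJC i).1.2).1 0)
  have hJsub : ∀ i : J, {x : Fin 1 → ℝ | x 0 ∈ Ioo i.1.1 i.1.2} ⊆ w.domain := fun i x hx =>
    (hdomA x).2 ((hJC i).2.2.2 hx)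
  set R : J → IntegralRep 1 := fun i => w.restrict _ (hJsa i) (hJsub i) with hR
  -- rule (1): `[w] − ∑ [R i] ∈ relations` (the cells cover `A` off `C`; they are pairwise disjoint)
  have hN : volume {x : Fin 1 → ℝ | x 0 ∈ (C : Set ℝ)} = 0 := by
    rw [show {x : Fin 1 → ℝ | x 0 ∈ (C : Set ℝ)} = ⋃ c ∈ (C : Set ℝ), {x : Fin 1 → ℝ | x 0 = c} by
      ext x; simp, measure_biUnion_null_iff C.countable_toSet]
    intro c _
    rw [volume_pi]
    exact Measure.pi_hyperplane (α := fun _ : Fin 1 => ℝ) (fun _ => volume) 0 c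
  have key : ∀ i j : J, ∀ t : ℝ, t ∈ Ioo i.1.1 i.1.2 → t ∈ Ioo j.1.1 j.1.2 →
      j.1.1 ≤ i.1.1 ∧ i.1.2 ≤ j.1.2 := fun i j t hi hj =>
    ⟨not_lt.1 fun h => (hJC i).2.2.1 _ (hJC j).1.1 ⟨h, hj.1.trans hi.2⟩,
      not_lt.1 fun h => (hJC i).2.2.1 _ (hJC j).1.2 ⟨hi.1.trans hj.2, h⟩⟩
  have e1 : of w - ∑ i, of (R i) ∈ relations := by
    refine of_sub_sum_of_mem_relations Finset.univ w R (fun i _ => ?_) (fun i _ _ _ => rfl) ?_ ?_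
    · rw [show (R i).domain \ w.domain = ∅ from sdiff_eq_empty.mpr (hJsub i), measure_empty]
    · refine measure_mono_null (fun x hx => ?_) hN
      by_contra hxC
      have hxA : x 0 ∈ A := (hdomA x).1 hx.1
      obtain ⟨a, ha, b, hb, hxab, hav⟩ :=
        decomp_exists_cell C h2C h2C' (hAI _ hxA).1 (hAI _ hxA).2 hxC
      have hsub : Ioo a b ⊆ Ioo (-2:ℝ) 2 := fun t ht =>
        ⟨(hC' a ha).2.1.trans_lt ht.1, ht.2.trans_le (hC' b hb).2.2⟩
      have hJab : (a, b) ∈ J := by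
        refine Finset.mem_filter.2 ⟨Finset.mem_product.2 ⟨ha, hb⟩, hxab.1.trans hxab.2, hav,
          fun t ht => ?_⟩
        exact CurvePeriodsTransfer.mem_of_mem_of_cell (A := A) (fun x y hxy he => hE x y hxy he)
          hsub (fun e he heI => hav e (hEC e he heI)) hxab ht hxA
      exact hx.2 (mem_iUnion₂.2 ⟨⟨(a, b), hJab⟩, Finset.mem_univ _, hxab⟩)
    · intro i _ j _ hij
      rw [show (R i).domain ∩ (R j).domain = ∅ from Set.eq_empty_of_forall_notMem fun x hx =>
        hij (Subtype.ext (Prod.ext (le_antisymm (key j i _ hx.2 hx.1).1 (key i j _ hx.1 hx.2).1)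
          (le_antisymm (key i j _ hx.1 hx.2).2 (key j i _ hx.2 hx.1).2))), measure_empty]
  -- rule (2): each cell is moved onto `(0, 1)`
  have e2 : ∀ i : J, ∃ (k : ℕ) (v : Fin k → IntegralRep 1),
      (∀ j, (v j).domain = {x : Fin 1 → ℝ | x 0 ∈ Set.Ioo (0:ℝ) 1} ∧
        ∀ s ∈ Set.Ioo (0:ℝ) 1, AnalyticAt ℝ (fun s : ℝ => (v j).integrand (fun _ => s)) s) ∧
      of (R i) - ∑ j, of (v j) ∈ relations := fun i => by
    obtain ⟨hiC, hlt, hav, hIA⟩ := hJC i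
    have hsub : Ioo i.1.1 i.1.2 ⊆ Ioo (-2:ℝ) 2 := fun t ht =>
      ⟨(hC' _ hiC.1).2.1.trans_lt ht.1, ht.2.trans_le (hC' _ hiC.2).2.2⟩
    obtain ⟨v, hv, hrel⟩ := decomp_affine (R i) hlt (hC' _ hiC.1).1 (hC' _ hiC.2).1 rfl
      fun s hs => (hanal s (hsub hs) fun h => hav s (hBC s h) hs).congr
        (Filter.eventuallyEq_of_mem (Ioo_mem_nhds hs.1 hs.2) fun t ht =>
          indicator_of_mem (show (fun _ : Fin 1 => t) ∈ w.domain from hIA ht) _)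
    exact ⟨1, fun _ => v, fun _ => hv, by rw [Fin.sum_univ_one]; exact hrel⟩
  obtain ⟨k, v, hv, hsum⟩ := decomp_concat
    (fun v : IntegralRep 1 => v.domain = {x : Fin 1 → ℝ | x 0 ∈ Set.Ioo (0:ℝ) 1} ∧
      ∀ s ∈ Set.Ioo (0:ℝ) 1, AnalyticAt ℝ (fun s : ℝ => v.integrand (fun _ => s)) s)
    Finset.univ R fun i _ => e2 i
  exact ⟨k, v, hv, by simpa only [sub_add_sub_cancel] using relations.add_mem e1 hsum⟩

/-! ### The stub -/

/-- **R7 (decomposition into analytic pieces on `(0,1)`).** Every one-dimensional representation is,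
modulo the KZ relations, a finite sum of representations on the open unit interval with integrands
analytic on `(0, 1)`: compactification of the domain by the inversion charts (`decomp_compactify`),
finite-boundary structure of the domain and analyticity of the integrand off finitely many algebraic
points (`stub_saPieceFacts`), splitting at the finitely many cut points (rule (1); points are null),
and affine rule-(2) moves with real-algebraic, hence `ℚ`-definable, coefficients onto `(0, 1)`
(`decomp_bounded`); the granted hypothesis (analyticity off a finite set, stub R2) is subsumed by
`stub_saPieceFacts`. [van den Dries 1998, Ch. 3 (1.2); Kontsevich–Zagier 2001, §1.2] [folklore] -/
theorem stub_decomposeDimOne :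
    (∀ (f : ℝ → ℝ) (lo hi : ℝ), lo < hi → ContinuousOn f (Set.Ioo lo hi) → (∃ P : MvPolynomial (Fin 2) ℝ, P ≠ 0 ∧ ∀ s ∈ Set.Ioo lo hi, MvPolynomial.eval ![s, f s] P = 0) → ∃ Z : Finset ℝ, ∀ s ∈ Set.Ioo lo hi, s ∉ Z → AnalyticAt ℝ f s) → ∀ (u : IntegralRep 1), ∃ (k : ℕ) (v : Fin k → IntegralRep 1), (∀ i, (v i).domain = {x : Fin 1 → ℝ | x 0 ∈ Set.Ioo (0:ℝ) 1} ∧ ∀ s ∈ Set.Ioo (0:ℝ) 1, AnalyticAt ℝ (fun s : ℝ => (v i).integrand (fun _ => s)) s) ∧ of u - ∑ i, of (v i) ∈ relations := by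
  intro _ u
  obtain ⟨R, hR, hrel⟩ := decomp_compactify u
  obtain ⟨k, v, hv, hsum⟩ := decomp_concat
    (fun v : IntegralRep 1 => v.domain = {x : Fin 1 → ℝ | x 0 ∈ Set.Ioo (0:ℝ) 1} ∧
      ∀ s ∈ Set.Ioo (0:ℝ) 1, AnalyticAt ℝ (fun s : ℝ => v.integrand (fun _ => s)) s)
    Finset.univ R fun T _ => decomp_bounded (R T) (hR T)
  exact ⟨k, v, hv, by simpa only [sub_add_sub_cancel] using relations.add_mem hrel hsum⟩

end Summit.KontsevichZagierPeriods.FurushoPentagon.SectorToKernel
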